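import Literature.Probability.LatticeModels.AnnulusManeuver
import HarnessLib

/-!
# The circuit maneuver NE-ccw: a counter-clockwise circuit of the frame avoiding a north-eastward slit

Topic `Literature/Probability/LatticeModels`; a companion of `AnnulusManeuver.lean` (same
`MStep` technology, same region `mW c k = [c - 48k, c + 48k]²`), the design `NE-ccw` — the
mirror image `(x, y) ↦ (y, x)` of the design `NE-cw` — of the lattice half of Chelkak's
"crossings of annuli" lemma (D. Chelkak, Robust discrete complex analysis: a toolbox, Ann.
Probab. 44 (2016), Lemma 2.12), in the form consumed by the corrected boundary-decay lemma (his
Lemma 2.14) for the edge-killed walk near a slit pointing north-east.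

Statement. The free simple random walk on `ℤ²` started in the box `[-9k, -k] × [20k, 28k]`
(relative to the centre `c`) performs, with probability at least the universal constant
`circNEccwConst > 0` (`circNEccwConst_pos`, `circNEccwConst_le_chainM` for the free chain
`chainM` of `ManeuverChain.lean`), the counter-clockwise circuit "top strip right → left (the part
left of the slit), turn, left strip top → bottom (full height), turn, bottom strip left → right,
turn, right strip bottom → top up to height `-6k`", a ten-step maneuver of rectangles
(`circNEccw`) inside `mW c k` (`circNEccwU_subset_mW`, `circNEccwL_subset_mW`) which never enters
the north-eastward slit wedge `{z : X ≥ -2, Y ≥ -2, 7X - 17Y ≤ 23, 7Y - 17X ≤ 23}`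
(`X = z₀ - c₀ + 6k`, `Y = z₁ - c₁ + 6k`) nor the germ box `-8k ≤ z₀ - c₀, z₁ - c₁ ≤ -4k`
(`circNEccw_avoids`, for `k ≥ 5`). Moreover a positive KILLED chain `chainN` at a point of the
start set in `S` yields four transversal strip crossings by walks inside `S`
(`circNEccw_crossings_of_chainN_pos`): left → right of the top strip from abscissa `-36k` to `-9k`,
bottom → top of the full left strip, left → right of the full bottom strip, and bottom → top of
the right strip from height `-36k` to `-9k`.

Proof: as in `AnnulusManeuver.lean` — the design checks `L i ⊆ T (i+1)`, containment in `mW`,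
avoidance, are decided by `omega`; the lower bound for the free chain is the downward induction
`circNEccwTailConst_le_chainM` with the one-step bound `MStep.lower_bound` (every step has
dimensions `≥ 8`); the crossings are extracted from the walks of steps `0, 3, 6, 9` given by
`exists_walk_of_chainN_pos` (`circNEccw_iter_step`) with `exists_subwalk_slab`. Everything is
proved.

## References

* D. Chelkak, Robust discrete complex analysis: a toolbox, Ann. Probab. 44 (2016) 628–683,
  Lemma 2.12 (crossings of annuli) and Lemma 2.14 — bib key `Chelkak2016`.
* S. Smirnov, Ann. of Math. 172 (2010) 1435–1467, App. B (maneuvers of rectangles) — bib key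
  `Smirnov2010`.
-/

noncomputable section

namespace Literature.Probability.LatticeModels

open Set SimpleGraph

/-! ### The ten steps -/

/-- **The counter-clockwise circuit for a north-eastward slit** (units of `k`, centre `c`;
`⟨α, β, w, h, side⟩` = open rectangle `(αk, αk + wk) × (βk, βk + hk)`, exit side `0` right /
`1` top / `2` left / `3` bottom): from the start box `[-9, -1] × [20, 28]` cross the left part
`(-40, 0) × (12, 36)` of the top strip right to left, turn (two connectors into the top-left
corner), cross the full left strip `(-36, -12) × (-40, 46)` top to bottom, turn, cross the bottom
strip `(-46, 40) × (-36, -12)` left to right, turn, and cross the lower part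
`(12, 36) × (-46, -6)` of the right strip bottom to top, exiting at height `-6k`; all inside
`[-48, 48]²`, away from the north-eastward slit wedge at `c - (6k, 6k)` and from the germ box
`[-8, -4]²`. Landing sets are middle halves of exit sides, start sets transverse middle thirds,
and each landing set lies in the next start set. [cite: Chelkak2016, Lemma 2.12] -/
def circNEccw : Fin 10 → MStep :=
  ![⟨-40, 12, 40, 24, 2⟩, ⟨-44, 6, 8, 35, 1⟩, ⟨-46, 37, 22, 8, 0⟩, ⟨-36, -40, 24, 86, 3⟩,
    ⟨-41, -44, 35, 8, 2⟩, ⟨-45, -46, 8, 22, 1⟩, ⟨-46, -36, 86, 24, 0⟩, ⟨24, -42, 20, 36, 2⟩,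
    ⟨16, -44, 16, 40, 3⟩, ⟨12, -46, 24, 40, 1⟩]

section NEccw
variable (c : Site 2) (k : ℕ)

/-- Rectangles of the design (empty beyond the tenth). [folklore] -/
def circNEccwU (i : ℕ) : Set (Site 2) := if h : i < 10 then (circNEccw ⟨i, h⟩).U c k else ∅
/-- Landing sets of the design (empty beyond the tenth). [folklore] -/
def circNEccwL (i : ℕ) : Set (Site 2) := if h : i < 10 then (circNEccw ⟨i, h⟩).L c k else ∅
/-- Start sets of the design (everything beyond the tenth). [folklore] -/
def circNEccwT (i : ℕ) : Set (Site 2) := if h : i < 10 then (circNEccw ⟨i, h⟩).T c k else Set.univ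
/-- Step constants (`1` beyond the tenth). [folklore] -/
def circNEccwStepConst (i : ℕ) : ℝ := if h : i < 10 then (circNEccw ⟨i, h⟩).const else 1
/-- The circuit constant `∏_{i<10} c_i` (a universal constant). [folklore] -/
def circNEccwConst : ℝ := ∏ i ∈ Finset.range 10, circNEccwStepConst i

/-! ### Constants -/

/-- The step constants are positive. [folklore] -/
theorem circNEccwStepConst_pos (i : ℕ) : 0 < circNEccwStepConst i := by
  unfold circNEccwStepConst; split_ifs with h
  · apply MStep.const_pos <;> interval_cases i <;> simp [circNEccw]
  · exact one_pos

/-- **The circuit constant is positive.** [folklore] -/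
theorem circNEccwConst_pos : 0 < circNEccwConst := Finset.prod_pos fun i _ => circNEccwStepConst_pos i

/-- The tail products `∏_{i ≤ j < 10} c_j`. [folklore] -/
def circNEccwTailConst (i : ℕ) : ℝ := ∏ j ∈ Finset.Ico i 10, circNEccwStepConst j

/-- Tail products are positive. [folklore] -/
theorem circNEccwTailConst_pos (i : ℕ) : 0 < circNEccwTailConst i :=
  Finset.prod_pos fun j _ => circNEccwStepConst_pos j

/-- `tail i = c_i · tail (i+1)` for `i < 10`. [folklore] -/
theorem circNEccwTailConst_succ {i : ℕ} (hi : i < 10) :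
    circNEccwTailConst i = circNEccwStepConst i * circNEccwTailConst (i + 1) := by
  unfold circNEccwTailConst
  rw [Finset.prod_eq_prod_Ico_succ_bot hi]

/-! ### Design checks -/

/-- The rectangles are finite. [folklore] -/
theorem circNEccwU_finite : ∀ i, (circNEccwU c k i).Finite := by
  intro i
  unfold circNEccwU; split_ifs
  · exact rectInterior_finite _ _ _
  · exact Set.finite_empty

/-- **Design check: each landing set lies in the next start set.** [folklore] -/
theorem circNEccwL_subset_T (hk : 0 < k) {i : ℕ} (hi : i < 10) : circNEccwL c k i ⊆ circNEccwT c k (i + 1) := by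
  intro x hx
  interval_cases i <;>
    simp only [circNEccwL, circNEccwT, circNEccw, MStep.L, MStep.T, MStep.U, MStep.corner, rectInterior,
      Set.mem_setOf_eq, Matrix.cons_val_zero, Matrix.cons_val_one,
      show (9 : ℕ) + 1 < 10 ↔ False by decide, dite_false, Set.mem_univ] at hx ⊢ <;>
    simp at hx ⊢ <;> omega

/-- Start sets lie in their rectangles. [folklore] -/
theorem circNEccwT_subset_U {i : ℕ} (hi : i < 10) : circNEccwT c k i ⊆ circNEccwU c k i := by
  intro x hx
  simp only [circNEccwT, circNEccwU, dif_pos hi] at hx ⊢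
  exact hx.1

/-- **Design check: the rectangles lie in the region `mW c k`.** [folklore] -/
theorem circNEccwU_subset_mW : ∀ i, circNEccwU c k i ⊆ mW c k := by
  intro i x hx
  by_cases hi : i < 10
  · simp only [mW, Set.mem_setOf_eq, abs_le]
    interval_cases i <;>
      simp only [circNEccwU, circNEccw, MStep.U, MStep.corner, rectInterior,
        Matrix.cons_val_zero, Matrix.cons_val_one] at hx <;>
      simp at hx <;> omega
  · simp [circNEccwU, hi] at hx

/-- **Design check: the landing sets lie in the region `mW c k`.** [folklore] -/
theorem circNEccwL_subset_mW : 0 < k → ∀ i, circNEccwL c k i ⊆ mW c k := by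
  intro hk i x hx
  by_cases hi : i < 10
  · simp only [mW, Set.mem_setOf_eq, abs_le]
    interval_cases i <;>
      simp only [circNEccwL, circNEccw, MStep.L] at hx <;>
      simp at hx <;> omega
  · simp [circNEccwL, hi] at hx

/-- **Design check: landing sets are disjoint from their (open) rectangles.** [folklore] -/
theorem disjoint_circNEccwU_L : ∀ i, Disjoint (circNEccwU c k i) (circNEccwL c k i) := by
  intro i
  rw [Set.disjoint_left]
  intro x hxU hxL
  by_cases hi : i < 10
  · interval_cases i <;>
      simp only [circNEccwU, circNEccwL, circNEccw, MStep.L, MStep.U, MStep.corner, rectInterior,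
        Matrix.cons_val_zero, Matrix.cons_val_one] at hxU hxL <;>
      simp at hxU hxL <;> omega
  · simp [circNEccwU, hi] at hxU

/-- **Design check: the start box `[-9k, -k] × [20k, 28k]` lies in the first start set.** [folklore] -/
theorem circNEccw_start : 0 < k → ∀ x : Site 2, -9 * (k : ℤ) ≤ x 0 - c 0 → x 0 - c 0 ≤ -1 * k → 20 * k ≤ x 1 - c 1 →
    x 1 - c 1 ≤ 28 * k → x ∈ circNEccwT c k 0 := by
  intro hk x h1 h2 h3 h4
  simp only [circNEccwT, circNEccw, MStep.T, MStep.U, MStep.corner, rectInterior, Set.mem_setOf_eq,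
    Matrix.cons_val_zero, Matrix.cons_val_one, show (0 : ℕ) < 10 by decide, dite_true]
  simp
  omega

/-- **Design check: avoidance.** For `k ≥ 5` no rectangle or landing set of the design meets the
germ box `-8k ≤ z₀ - c₀, z₁ - c₁ ≤ -4k` or the north-eastward slit wedge
`{X ≥ -2, Y ≥ -2, 7X - 17Y ≤ 23, 7Y - 17X ≤ 23}` (`X = z₀ - c₀ + 6k`, `Y = z₁ - c₁ + 6k`). [folklore] -/
theorem circNEccw_avoids : 5 ≤ k → ∀ i, ∀ z ∈ circNEccwU c k i ∪ circNEccwL c k i,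
    (z 0 - c 0 < -8 * k ∨ -4 * (k : ℤ) < z 0 - c 0 ∨ z 1 - c 1 < -8 * k ∨ -4 * (k : ℤ) < z 1 - c 1) ∧
    (z 0 - c 0 + 6 * k < -2 ∨ z 1 - c 1 + 6 * k < -2 ∨
      23 < 7 * (z 0 - c 0 + 6 * k) - 17 * (z 1 - c 1 + 6 * k) ∨ 23 < 7 * (z 1 - c 1 + 6 * k) - 17 * (z 0 - c 0 + 6 * k)) := by
  intro hk i z hz
  by_cases hi : i < 10
  · interval_cases i <;>
      simp only [circNEccwU, circNEccwL, circNEccw, MStep.L, MStep.U, MStep.corner, rectInterior, Set.mem_union,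
        Matrix.cons_val_zero, Matrix.cons_val_one] at hz <;>
      simp at hz <;> omega
  · simp [circNEccwU, circNEccwL, hi] at hz

/-! ### The free chain is bounded below on the start set -/

/-- **The free chain is at least the tail product on the start sets**: downward induction with
the one-step lower bound `MStep.lower_bound` and the design check `L i ⊆ T (i+1)`. [folklore] -/
theorem circNEccwTailConst_le_chainM (hk : 0 < k) {j : ℕ} (hj : j ≤ 10) {x : Site 2} (hx : x ∈ circNEccwT c k (10 - j)) :
    circNEccwTailConst (10 - j) ≤ chainM (circNEccwU c k) (circNEccwL c k) 10 j x := by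
  classical
  induction j generalizing x with
  | zero => simp [circNEccwTailConst, chainM]
  | succ j ih =>
    have hi : 10 - (j + 1) < 10 := by omega
    set i := 10 - (j + 1) with hidef
    have hi' : 10 - 1 - j = i := by omega
    have hsucc : 10 - j = i + 1 := by omega
    simp only [chainM, hi']
    rw [circNEccwTailConst_succ hi]
    -- the data `g = 1_{L i} · M_j`
    have hM0 : ∀ w, 0 ≤ chainM (circNEccwU c k) (circNEccwL c k) 10 j w :=
      fun w => (chainM_mem_Icc (circNEccwU_finite c k) j w).1
    have hT : ∀ w ∈ circNEccwL c k i, circNEccwTailConst (i + 1) ≤ chainM (circNEccwU c k) (circNEccwL c k) 10 j w := by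
      intro w hw
      have := ih (by omega) (x := w) (by rw [hsucc]; exact circNEccwL_subset_T c k hk hi hw)
      rwa [hsucc] at this
    have key := MStep.lower_bound (circNEccw ⟨i, hi⟩) c k hk (by interval_cases i <;> simp [circNEccw])
      (by interval_cases i <;> simp [circNEccw])
      (g := fun w => if w ∈ circNEccwL c k i then chainM (circNEccwU c k) (circNEccwL c k) 10 j w else 0)
      (fun w => by split_ifs <;> [exact hM0 w; exact le_rfl]) (circNEccwTailConst_pos (i + 1)).le
      (fun w hw => by
        have hw' : w ∈ circNEccwL c k i := by simp only [circNEccwL, dif_pos hi]; exact hw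
        simp only [hw', if_true]; exact hT w hw') (x := x) (by simp only [circNEccwT, dif_pos hi] at hx; exact hx)
    rw [mul_comm]
    have hU : (circNEccw ⟨i, hi⟩).U c k = circNEccwU c k i := by simp only [circNEccwU, dif_pos hi]
    have hc : (circNEccw ⟨i, hi⟩).const = circNEccwStepConst i := by simp only [circNEccwStepConst, dif_pos hi]
    rw [hU, hc] at key
    exact key

/-- **`M ≥ c_*` on the first start set** (in particular on the start box, `circNEccw_start`):
the free walk performs the circuit with probability at least `circNEccwConst`. [cite: Chelkak2016, Lemma 2.12] -/
theorem circNEccwConst_le_chainM : 0 < k → ∀ x ∈ circNEccwT c k 0,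
    circNEccwConst ≤ chainM (circNEccwU c k) (circNEccwL c k) 10 10 x := by
  intro hk x hx
  have h := circNEccwTailConst_le_chainM c k hk le_rfl (x := x) hx
  have e : circNEccwTailConst (10 - 10) = circNEccwConst := by
    simp only [Nat.sub_self, circNEccwTailConst, circNEccwConst, Finset.range_eq_Ico]
  rw [e] at h; exact h

/-! ### A positive killed chain forces four strip crossings inside `S` -/

/-- One step of the killed circuit inside `S` (wrapper of `exists_walk_of_chainN_pos`). [folklore] -/
theorem circNEccw_iter_step {S : Set (Site 2)} {i : ℕ} (hi : i < 10) {y : Site 2} (hy : y ∈ circNEccwU c k i)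
    (hyS : y ∈ S) (hpos : 0 < chainN (circNEccwU c k) (circNEccwL c k) S 10 (10 - i) y) :
    ∃ y', y' ∈ circNEccwL c k i ∧ y' ∈ S ∧ 0 < chainN (circNEccwU c k) (circNEccwL c k) S 10 (9 - i) y' ∧
      ∃ p : (zdGraph 2).Walk y y', ∀ z ∈ p.support, z ∈ S ∧ (z ∈ circNEccwU c k i ∨ z = y') := by
  have e1 : 10 - 1 - (9 - i) = i := by omega
  have e2 : 10 - i = (9 - i) + 1 := by omega
  rw [e2] at hpos
  have := exists_walk_of_chainN_pos (U := circNEccwU c k) (L := circNEccwL c k) (S := S) (n := 10)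
    (circNEccwU_finite c k) (9 - i) (x := y) (by rw [e1]; exact ⟨hy, hyS⟩) hpos
  rw [e1] at this
  exact this

/-- **Four strip crossings in `S`.** If the killed chain of the circuit is positive at a point
`x ∈ S` of the first start set with `x₀ ≥ c₀ - 9k`, then `S` contains a left–right crossing of
the top strip from abscissa `c₀ - 36k` to `c₀ - 9k` (inside `[c₀-36k, c₀-9k] × [c₁+12k, c₁+36k]`),
a bottom–top crossing of the left strip `[c₀-36k, c₀-12k] × [c₁-36k, c₁+36k]`, a left–right
crossing of the bottom strip `[c₀-36k, c₀+36k] × [c₁-36k, c₁-12k]`, and a bottom–top crossing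
of the right strip from height `c₁ - 36k` to `c₁ - 9k` (inside `[c₀+12k, c₀+36k] × [c₁-36k, c₁-9k]`)
— the lattice half of the crossings-of-annuli lemma. [cite: Chelkak2016, Lemma 2.12] -/
theorem circNEccw_crossings_of_chainN_pos {S : Set (Site 2)} : 0 < k → ∀ x ∈ circNEccwT c k 0, x ∈ S →
    c 0 - 9 * k ≤ x 0 → 0 < chainN (circNEccwU c k) (circNEccwL c k) S 10 10 x →
    (∃ (u v : Site 2) (σ : (zdGraph 2).Walk u v), u 0 = c 0 - 36 * k ∧ v 0 = c 0 - 9 * k ∧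
      ∀ z ∈ σ.support, z ∈ S ∧ c 0 - 36 * k ≤ z 0 ∧ z 0 ≤ c 0 - 9 * k ∧ c 1 + 12 * k ≤ z 1 ∧ z 1 ≤ c 1 + 36 * k) ∧
    (∃ (u v : Site 2) (σ : (zdGraph 2).Walk u v), u 1 = c 1 - 36 * k ∧ v 1 = c 1 + 36 * k ∧
      ∀ z ∈ σ.support, z ∈ S ∧ c 0 - 36 * k ≤ z 0 ∧ z 0 ≤ c 0 - 12 * k ∧ c 1 - 36 * k ≤ z 1 ∧ z 1 ≤ c 1 + 36 * k) ∧
    (∃ (u v : Site 2) (σ : (zdGraph 2).Walk u v), u 0 = c 0 - 36 * k ∧ v 0 = c 0 + 36 * k ∧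
      ∀ z ∈ σ.support, z ∈ S ∧ c 0 - 36 * k ≤ z 0 ∧ z 0 ≤ c 0 + 36 * k ∧ c 1 - 36 * k ≤ z 1 ∧ z 1 ≤ c 1 - 12 * k) ∧
    (∃ (u v : Site 2) (σ : (zdGraph 2).Walk u v), u 1 = c 1 - 36 * k ∧ v 1 = c 1 - 9 * k ∧
      ∀ z ∈ σ.support, z ∈ S ∧ c 0 + 12 * k ≤ z 0 ∧ z 0 ≤ c 0 + 36 * k ∧ c 1 - 36 * k ≤ z 1 ∧ z 1 ≤ c 1 - 9 * k) := by
  intro hk x hx hxS hx0 hpos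
  have hTU : ∀ {i : ℕ} (_ : i + 1 < 10) {y : Site 2}, y ∈ circNEccwL c k i → y ∈ circNEccwU c k (i + 1) :=
    fun {i} hi {y} hy => circNEccwT_subset_U c k hi (circNEccwL_subset_T c k hk (by omega) hy)
  -- the ten steps
  have hxU : x ∈ circNEccwU c k 0 := circNEccwT_subset_U c k (by decide) hx
  obtain ⟨y1, hL1, hS1, hp1, p0, hw0⟩ := circNEccw_iter_step c k (by decide : 0 < 10) hxU hxS hpos
  obtain ⟨y2, hL2, hS2, hp2, -⟩ := circNEccw_iter_step c k (by decide : 1 < 10) (hTU (by decide) hL1) hS1 hp1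
  obtain ⟨y3, hL3, hS3, hp3, -⟩ := circNEccw_iter_step c k (by decide : 2 < 10) (hTU (by decide) hL2) hS2 hp2
  obtain ⟨y4, hL4, hS4, hp4, p3, hw3⟩ := circNEccw_iter_step c k (by decide : 3 < 10) (hTU (by decide) hL3) hS3 hp3
  obtain ⟨y5, hL5, hS5, hp5, -⟩ := circNEccw_iter_step c k (by decide : 4 < 10) (hTU (by decide) hL4) hS4 hp4
  obtain ⟨y6, hL6, hS6, hp6, -⟩ := circNEccw_iter_step c k (by decide : 5 < 10) (hTU (by decide) hL5) hS5 hp5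
  obtain ⟨y7, hL7, hS7, hp7, p6, hw6⟩ := circNEccw_iter_step c k (by decide : 6 < 10) (hTU (by decide) hL6) hS6 hp6
  obtain ⟨y8, hL8, hS8, hp8, -⟩ := circNEccw_iter_step c k (by decide : 7 < 10) (hTU (by decide) hL7) hS7 hp7
  obtain ⟨y9, hL9, hS9, hp9, -⟩ := circNEccw_iter_step c k (by decide : 8 < 10) (hTU (by decide) hL8) hS8 hp8
  obtain ⟨y10, hL10, -, -, p9, hw9⟩ := circNEccw_iter_step c k (by decide : 9 < 10) (hTU (by decide) hL9) hS9 hp9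
  -- coordinates of the landing points and of the supports
  simp only [circNEccwL, circNEccwU, circNEccw, MStep.L, MStep.U, MStep.corner, rectInterior, Set.mem_setOf_eq,
    Matrix.cons_val_zero, Matrix.cons_val_one, show (0:ℕ) < 10 by decide, show (2:ℕ) < 10 by decide,
    show (3:ℕ) < 10 by decide, show (5:ℕ) < 10 by decide, show (6:ℕ) < 10 by decide, show (8:ℕ) < 10 by decide,
    show (9:ℕ) < 10 by decide, dif_pos] at hL1 hL3 hL4 hL6 hL7 hL9 hL10 hw0 hw3 hw6 hw9
  simp at hL1 hL3 hL4 hL6 hL7 hL9 hL10 hw0 hw3 hw6 hw9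
  refine ⟨?_, ?_, ?_, ?_⟩
  · -- top strip from `p0 : x → y1`, reversed
    obtain ⟨u, v, σ, hu, hv, hsub, hσ⟩ := exists_subwalk_slab p0.reverse 0 (L := c 0 - 36 * k) (R := c 0 - 9 * k)
      (by omega) (by omega) (by omega)
    refine ⟨u, v, σ, hu, hv, fun z hz => ?_⟩
    have hz' : z ∈ p0.support := by have := hsub z hz; rwa [Walk.support_reverse, List.mem_reverse] at this
    have h1 := hw0 z hz'; have h2 := hσ z hz
    refine ⟨h1.1, h2.1, h2.2, ?_, ?_⟩ <;> rcases h1.2 with h | rfl <;> omega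
  · -- left strip from `p3 : y3 → y4`, reversed
    obtain ⟨u, v, σ, hu, hv, hsub, hσ⟩ := exists_subwalk_slab p3.reverse 1 (L := c 1 - 36 * k) (R := c 1 + 36 * k)
      (by omega) (by omega) (by omega)
    refine ⟨u, v, σ, hu, hv, fun z hz => ?_⟩
    have hz' : z ∈ p3.support := by have := hsub z hz; rwa [Walk.support_reverse, List.mem_reverse] at this
    have h1 := hw3 z hz'; have h2 := hσ z hz
    refine ⟨h1.1, ?_, ?_, h2.1, h2.2⟩ <;> rcases h1.2 with h | rfl <;> omega
  · -- bottom strip from `p6 : y6 → y7`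
    obtain ⟨u, v, σ, hu, hv, hsub, hσ⟩ := exists_subwalk_slab p6 0 (L := c 0 - 36 * k) (R := c 0 + 36 * k)
      (by omega) (by omega) (by omega)
    refine ⟨u, v, σ, hu, hv, fun z hz => ?_⟩
    have h1 := hw6 z (hsub z hz); have h2 := hσ z hz
    refine ⟨h1.1, h2.1, h2.2, ?_, ?_⟩ <;> rcases h1.2 with h | rfl <;> omega
  · -- right strip from `p9 : y9 → y10`
    obtain ⟨u, v, σ, hu, hv, hsub, hσ⟩ := exists_subwalk_slab p9 1 (L := c 1 - 36 * k) (R := c 1 - 9 * k)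
      (by omega) (by omega) (by omega)
    refine ⟨u, v, σ, hu, hv, fun z hz => ?_⟩
    have h1 := hw9 z (hsub z hz); have h2 := hσ z hz
    refine ⟨h1.1, ?_, ?_, h2.1, h2.2⟩ <;> rcases h1.2 with h | rfl <;> omega

end NEccw

end Literature.Probability.LatticeModels
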